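import Summits.QuantumFields.YangMills.Theorems.UnitScaleTiltProp7SectET3DeltaPiT3PInv
import Summits.QuantumFields.YangMills.Theorems.UnitScaleTiltProp7SectET3DeltaEtaExplicitT3
import Summits.QuantumFields.YangMills.Theorems.UnitScaleTiltProp7LandauDictT3
import Summits.QuantumFields.YangMills.Theorems.UnitScaleTiltProp7FirstVariationCurrent
import Summits.QuantumFields.YangMills.Theorems.UnitScaleTiltProp7SlotRowOfDeltaEta
import Summits.QuantumFields.YangMills.Theorems.UnitScaleTiltProp8FlatPlaqDeriv
import Literature.MathematicalPhysics.QuantumFieldTheory.Balaban1983to89.B9Eq3117Polarized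
import HarnessLib

/-!
# Route `UnitScaleTilt`, crux «MinimiserStabilityRegPr» (stmt-QuantumFields-19200), stub `stub_existenceMinimalOrbit` (EX), route (α) — «OPROW-139 DICT», FILE D1:
# THE PAIRING IDENTITY BEHIND PRINT'S (138) AT THE MEMBER — `⟪x, (Δ^η − Δ_πᴾ)F̃⟫ = ⟪D(G′ᴾR_SD* x), Δ^ηF̃⟫` on Landau `F̃` (algebra of `Δ_πᴾ = PᴾᵀΔ^ηPᴾ`), the polarized (3.117)
# `2⟨D^ηλ, ΔA⟩ = ⟨i[λ(b₋), A(b)] − i[A(b), R_bλ(b₊)], J⟩` (lit ✓`B9Eq3117Polarized.two_mul_bondPair_covDη_deltaOp` — EVERY background) READ AT THE MEMBER: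
# `⟪D(toL2S λ), Δ^η(toL2 F)⟫ = (c₀∕2η³)·⟨i[λᴴ(b₋), F(b)] − i[F(b), R_bλᴴ(b₊)], J₁⟩`, the pairing estimate, and the unit-spacing current on `RegPr`: `‖J₁(b)‖ ≤ α·η³` FROM THE DIVERGENCE CLAUSE

Cell `ym3-torus`, width seat `ym3-torus-px5` (gen 4; FILL-TO-CAP «width 5»); EX namer ★ym-ust-19200-w2 g8 WORD (2) 2026-08-29T03:49:08Z «px5: OPROW-139 GO (P-ℓ¹) — D1 `…DeltaPiDefectPairing`
then D2 `…Op139OfGaugeColumn`»; LOCATE-3 memo `HOME/ym3-torus-px5/g4/LOCATE-OPROW139-DICT-px5g4.md` (19200 evidence).  THEOREMS ONLY (0 `def`, 0 `sorry`); `--supports stmt-QuantumFields-19200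
--as helper`; count-neutral.  YM₃ on T³ is ladder rung R3, NOT the Clay problem; nothing here is a claim about the stub, the crux, d = 4 or the mass gap; NOTHING of print's estimates is asserted —
this file is exact algebra over landed letters plus two elementary bounds (a trace∕commutator count and the divergence clause of `RegPr` read for lit's current).

THE PRINT.  [Balaban1985BackgroundPropagators] p. 419 (3.117) *«⟨A − Dλ, Δ(A − Dλ)⟩ = ⟨A, ΔA⟩ − ⟨i[λ(b₋), A(b)] − i[A(b), R_bλ(b₊)] − i[λ(b₋), (Dλ)(b)], J⟩»*, (3.119)–(3.120) (`Δ_π`);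
[Balaban1985Variational] p. 299 *«2⟨A, Δ′_πHB⟩ = ⟨i[(G′RD*A)(b₋) + R_b(G′RD*A)(b₊), (HB)(b)], J⟩ (138) … The properties of HB and J imply the bound |Δ′_πHB|₍₋₃₎ ≤ O(1)|B| (139)»*;
[Balaban1985Variational] (2) p.278 ∕ [Balaban1985RegularSpaces] (1.9) p.77 (the divergence clause of the regular space, tree `T3PrintedRegularMinimiser.DivSmall`).
WHY THE DIVERGENCE CLAUSE (LOCATE-3 (V2)).  The member reading carries `c₀·η⁻³` (two powers from `Δ^η = η⁻²(D¹*D¹ + Δ′₁)`, one from `D = η⁻¹D¹`); the unit-spacing current `J₁ = D¹*(Im ∂U₀)` is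
`≤ α·η³` ONLY through `DivSmall` (`‖D¹*∂U₀‖ < α·L^{−3(K−n)}`); the plaquette clause alone gives `4αη²` and a defect row `∝ η⁻¹` — print's «properties of … J» ((28)∕(1.9)) is exactly this.

WHAT IS PROVED.
* §1 = lit ✓`B9Eq3117Polarized.two_mul_bondPair_covDη_deltaOp` BY NAME («`2⟨D^ηλ, ΔA⟩ = ⟨i[λ(b₋), A(b)] − i[A(b), R_bλ(b₊)], J⟩`», the `(A, λ)`-bilinear part of (3.117) =
  the content of print's (138); every background) — nothing re-proved here.
* §2 (member `F`, `n ≤ K`, weights `c₀ cB a`, background `U₀`; `T := torusT (F.P K) 0`, `U := fun μ x ↦ bgUnits F K U₀ ⟨x,μ⟩`, `τ := Matrix.traceLinearMap`):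
  ★ `inner_toL2_DeltaEta_toL2_eq_bondPair` (`⟪toL2 A, Δ^η(toL2 F)⟫ = c₀·η⁻²·bondPair₁(formComp Aᴴ, deltaOp₁(formComp F))`, ✓`DeltaEta_toL2_eq` + ✓`inner_toL2`),
  ★ `DL2_toL2S_eq_toL2_covDη` (✓`LandauDict.DL2_toL2S_eq_covDerivFwdT` in lit's `covDη` letter), ★ `formComp_star_covDη` (unitary background),
  ★★★ `inner_DL2_toL2S_DeltaEta_toL2` — **`⟪D_{U₀}(toL2S λ), Δ^η_{U₀}(toL2 F)⟫ = c₀·(η⁻¹)³·2⁻¹·bondPair 1 3 τ (i[λᴴ(b₋), F(b)] − i[F(b), R_bλᴴ(b₊)]) (J T U 1)`**,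
  ★★ `inner_DeltaEta_sub_DeltaPiP_of_landau` — **`⟪x, Δ^η y⟫ − ⟪x, Δ_πᴾ y⟫ = ⟪D(G′ᴾ(R_S(D* x))), Δ^η y⟫`** for `R_S(D* y) = 0` (✓`gaugeCorrP_apply`, ✓`inner_DeltaPiP`).
* §3 ★ `norm_bondPair_linJ_le` — `‖bondPair 1 3 τ (i[λ(b₋), F(b)] − i[F(b), R_bλ(b₊)]) E‖ ≤ 24·s·j·Σ_x‖λ x‖` for `‖F‖ ≤ s`, `‖E‖ ≤ j` (✓`FlatPlaqDeriv.norm_trace_mul_le` `|tr(MN)| ≤ 2‖M‖‖N‖`, lit ✓`norm_I_ad_le`, unitary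
  transport, the shift bijection; `2·2·(d + d)`, `d = 3` — the `L^∞(F) × L¹(λ)` shape dual to lit's ✓`norm_two_mul_bondPair_deltaOp_covDη_le`);
  ★★ `norm_J_one_le_of_regPr` — **`‖J T U 1 μ x‖ ≤ α·η³` on `RegPr F n K α U₀`** (`J₁ = −(I∕2)•(D*(∂U₀ − 1) − (D*(∂U₀ − 1))ᴴ)` by ✓`imC`, ✓`star_divP`;
  `D*(∂U₀ − 1) = covDivT 1 ∂U₀` by ★p1 ✓`Prop7FirstVariationCurrent.divP_plaqFT_sub_one_eq_covDivT`; then `RegPr.divSmall`).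
HONEST SCOPE.  Identities and two elementary bounds; the door `hOp139′π ⟸ hPcol` is FILE D2.  Nothing of (139)'s `O(1)`, Thm 3.1∕3.11, EX, the crux; nothing continuum ∕ OS ∕ mass-gap ∕ Clay.

References: T. Bałaban, CMP **99** (1985) 389–434 [Balaban1985BackgroundPropagators] ((3.8)–(3.12) p.392, (3.116)–(3.120) pp.418–419); CMP **102** (1985) 277–309 [Balaban1985Variational]
((2) p.278, (14) p.280, (28) p.282, (137)–(139) pp.298–299); CMP **99** (1985) 75–102 [Balaban1985RegularSpaces] ((1.9) p.77).
-/

set_option autoImplicit false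

noncomputable section

open scoped Matrix.Norms.L2Operator BigOperators InnerProductSpace ComplexConjugate
open Complex (I)

namespace Summit.QuantumFields.YangMills.Theorems.Prop7DeltaPiDefectPairing

open Literature.MathematicalPhysics.QuantumFieldTheory.Balaban1983to89
open Literature.MathematicalPhysics.QuantumFieldTheory.Balaban1983to89.T3ContinuumYM3Torus
open T3PrintedRegularMinimiser (RegPr)
open T3SectALandauChart (formComp bgUnits eta eta_pos)
open B9TorusCalculus (torusT torusT_comm)
open B9Eq37Insertion (imC)
open B9Eq39Adjoint (R covD divP divPη plaqU bondPair J)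
open B9Eq310Hermitian (deltaOp star_covD star_divP plaqU_unitary norm_R_le)
open B9Eq3117Current (covDη covDη_apply bondPair_smul_left)
open B9Eq3117Polarized (two_mul_bondPair_covDη_deltaOp)
open B9Eq3131Pointwise (norm_I_ad_le)
open Beta.BackgroundVertices (ad)
open B10Eq68TorusRegularity (plaqFT covDivT)
open B10Eq27TorusAxialLog (unitsField toUField)
open B11Eq103H1Complex (SiteL2K BondL2K)
open Summit.QuantumFields.YangMills.Theorems.Prop7SectET3Transport (periodsT3)
open Summit.QuantumFields.YangMills.Theorems.Prop7SectET3HilbertLetters (W₂ toL2 toL2S inner_toL2 DL2 DstarL2)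
open Summit.QuantumFields.YangMills.Theorems.Prop7SectET3GaugeProjector (RS)
open Summit.QuantumFields.YangMills.Theorems.Prop7SectET3WilsonHessian (DeltaEta)
open Summit.QuantumFields.YangMills.Theorems.Prop7SectET3DeltaPiPInv (GprimeP gaugeCorrP DeltaPiP gaugeCorrP_apply inner_DeltaPiP)
open Summit.QuantumFields.YangMills.Theorems.Prop7SectET3DeltaEtaExplicit (DeltaEta_toL2_eq val_inv_bgUnits_eq_star sum_pbond_eq)
open Summit.QuantumFields.YangMills.Theorems.Prop7LandauDict (DL2_toL2S_eq_covDerivFwdT)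
open Summit.QuantumFields.YangMills.Theorems.Prop7SecondOrderDict (covDerivFwdT_eq_smul_covD norm_bgUnits_le_one val_plaqU_torusT_eq_plaqFT)
open Summit.QuantumFields.YangMills.Theorems.Prop7FirstVariationCurrent (divP_plaqFT_sub_one_eq_covDivT)
open Summit.QuantumFields.YangMills.Theorems.Prop7SlotRowOfDeltaEta (traceLinearMap_mul_comm)

/-! ## §2 The member readings -/

section Member

variable {F : T3Family} {n K : ℕ} {h : n ≤ K} {c₀ cB a : ℝ}

/-- ★ **`⟪toL2 A, Δ^η_{U₀}(toL2 F)⟫ = c₀·(η⁻¹)²·bondPair 1 3 tr (formComp Aᴴ) (deltaOp₁(formComp F))`** — print's (3.10)∕(3.11) at the member (✓`DeltaEta_toL2_eq` + ✓`inner_toL2`), unit spacing inside,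
the `η⁻²` in front. [cite: Balaban1985BackgroundPropagators, (3.10)–(3.12) p.392] -/
theorem inner_toL2_DeltaEta_toL2_eq_bondPair [Fact (0 < c₀)] (U₀ : GaugeField (F.P K) 0 (Matrix.specialUnitaryGroup (Fin 2) ℂ)) (A X : PBond (F.P K) 0 → Matrix (Fin 2) (Fin 2) ℂ) :
    ⟪toL2 F K c₀ A, DeltaEta F n K c₀ U₀ (toL2 F K c₀ X)⟫_ℂ
      = (c₀ : ℂ) * ((((eta F n K)⁻¹ ^ 2 : ℝ) : ℂ)) *
          bondPair 1 3 (Matrix.traceLinearMap (Fin 2) ℂ ℂ) (formComp (star A))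
            (deltaOp (torusT (F.P K) 0) (fun μ x => bgUnits F K U₀ ⟨x, μ⟩) 1 (formComp X)) := by
  rw [DeltaEta_toL2_eq, inner_toL2, bondPair, sum_pbond_eq]
  simp only [Complex.ofReal_one, one_pow, one_mul, Matrix.mul_smul, Matrix.trace_smul, smul_eq_mul, Matrix.traceLinearMap_apply, mul_assoc]
  congr 1
  rw [Finset.mul_sum]
  refine Finset.sum_congr rfl fun x _ => ?_
  rw [Finset.mul_sum]
  refine Finset.sum_congr rfl fun μ _ => ?_
  rfl

/-- The real scalar `r⁻¹` acts on `M₂(ℂ)` as the complex scalar `(↑r)⁻¹`. [folklore] -/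
theorem real_inv_smul_eq_coe_inv_smul (r : ℝ) (M : Matrix (Fin 2) (Fin 2) ℂ) : r⁻¹ • M = ((r : ℂ)⁻¹) • M := by
  ext i j
  simp [Matrix.smul_apply, Complex.ofReal_inv]

/-- ★ **`D_{U₀}(toL2S λ) = toL2 (D^η_{U₀}λ)`** with lit's `covDη T U η λ` at `η := eta F n K` (✓`LandauDict.DL2_toL2S_eq_covDerivFwdT`, ✓`covDerivFwdT_eq_smul_covD`; the real scalar `η⁻¹` read as the complex one).
[cite: Balaban1985BackgroundPropagators, (3.3) p.391] -/
theorem DL2_toL2S_eq_toL2_covDη [Fact (0 < c₀)] (U₀ : GaugeField (F.P K) 0 (Matrix.specialUnitaryGroup (Fin 2) ℂ)) (lam : Site (F.P K) 0 → Matrix (Fin 2) (Fin 2) ℂ) :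
    DL2 F n K c₀ U₀ (toL2S F K c₀ lam)
      = toL2 F K c₀ (fun b => covDη (torusT (F.P K) 0) (fun μ x => bgUnits F K U₀ ⟨x, μ⟩) (eta F n K) lam b.dir b.src) := by
  rw [← LinearEquiv.symm_apply_eq]
  funext b
  rw [DL2_toL2S_eq_covDerivFwdT, covDerivFwdT_eq_smul_covD, covDη_apply]
  exact real_inv_smul_eq_coe_inv_smul _ _

/-- ★ **`(D^ηλ)ᴴ = D^η(λᴴ)` on the unitary background**, in the `formComp ∘ star` letter of the member reading. [cite: Balaban1985BackgroundPropagators, (3.5) p.391] -/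
theorem formComp_star_covDη (U₀ : GaugeField (F.P K) 0 (Matrix.specialUnitaryGroup (Fin 2) ℂ)) (η : ℝ) (lam : Site (F.P K) 0 → Matrix (Fin 2) (Fin 2) ℂ) :
    formComp (star (fun b : PBond (F.P K) 0 => covDη (torusT (F.P K) 0) (fun μ x => bgUnits F K U₀ ⟨x, μ⟩) η lam b.dir b.src))
      = covDη (torusT (F.P K) 0) (fun μ x => bgUnits F K U₀ ⟨x, μ⟩) η (star lam) := by
  funext μ x
  show star (covDη (torusT (F.P K) 0) (fun μ x => bgUnits F K U₀ ⟨x, μ⟩) η lam μ x) = _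
  rw [covDη_apply, covDη_apply, star_smul, star_covD (torusT (F.P K) 0) _ (fun μ x => val_inv_bgUnits_eq_star U₀ μ x)]
  congr 1
  rw [star_inv₀, Complex.star_def, Complex.conj_ofReal]

/-- `covDη` at scale `η` is `η⁻¹` times `covDη` at scale `1`. [folklore] -/
theorem covDη_eq_smul_covDη_one (U₀ : GaugeField (F.P K) 0 (Matrix.specialUnitaryGroup (Fin 2) ℂ)) (η : ℝ) (lam : Site (F.P K) 0 → Matrix (Fin 2) (Fin 2) ℂ) :
    covDη (torusT (F.P K) 0) (fun μ x => bgUnits F K U₀ ⟨x, μ⟩) η lam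
      = fun μ x => ((η : ℂ)⁻¹) • covDη (torusT (F.P K) 0) (fun μ x => bgUnits F K U₀ ⟨x, μ⟩) 1 lam μ x := by
  funext μ x
  rw [covDη_apply, covDη_apply, Complex.ofReal_one, inv_one, one_smul]

/-- ★★★ **THE MEMBER READING OF (138)'s RIGHT SIDE: `⟪D_{U₀}(toL2S λ), Δ^η_{U₀}(toL2 F)⟫ = c₀·(η⁻¹)³·2⁻¹·⟨i[λᴴ(b₋), F(b)] − i[F(b), R_bλᴴ(b₊)], J₁⟩`** (`J₁ := J T U 1`, the unit-spacing current
of (3.11); lit ✓`two_mul_bondPair_covDη_deltaOp` at `η = 1`, `d = 3`, `τ := tr`). [cite: Balaban1985Variational, (138) p.299; Balaban1985BackgroundPropagators, (3.117) p.419, (3.10)–(3.11) p.392] -/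
theorem inner_DL2_toL2S_DeltaEta_toL2 [Fact (0 < c₀)] (U₀ : GaugeField (F.P K) 0 (Matrix.specialUnitaryGroup (Fin 2) ℂ))
    (lam : Site (F.P K) 0 → Matrix (Fin 2) (Fin 2) ℂ) (X : PBond (F.P K) 0 → Matrix (Fin 2) (Fin 2) ℂ) :
    ⟪DL2 F n K c₀ U₀ (toL2S F K c₀ lam), DeltaEta F n K c₀ U₀ (toL2 F K c₀ X)⟫_ℂ
      = (c₀ : ℂ) * ((((eta F n K)⁻¹ ^ 3 : ℝ) : ℂ)) * (2 : ℂ)⁻¹ *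
          bondPair 1 3 (Matrix.traceLinearMap (Fin 2) ℂ ℂ)
            (fun μ x => I • ad (star lam x) (formComp X μ x) - I • ad (formComp X μ x) (R (bgUnits F K U₀ ⟨x, μ⟩) (star lam (torusT (F.P K) 0 μ x))))
            (J (torusT (F.P K) 0) (fun μ x => bgUnits F K U₀ ⟨x, μ⟩) 1) := by
  set T := torusT (F.P K) 0 with hT
  set U : Fin (F.P K).d → Site (F.P K) 0 → (Matrix (Fin 2) (Fin 2) ℂ)ˣ := fun μ x => bgUnits F K U₀ ⟨x, μ⟩ with hU
  have hη : eta F n K ≠ 0 := (eta_pos F n K).ne'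
  rw [DL2_toL2S_eq_toL2_covDη, inner_toL2_DeltaEta_toL2_eq_bondPair, formComp_star_covDη, covDη_eq_smul_covDη_one U₀ (eta F n K),
    bondPair_smul_left]
  -- lit's polarized (3.117) at `η = 1`, `d = 3`, `τ := tr` (as a continuous linear map)
  have hτ' : ∀ a b : Matrix (Fin 2) (Fin 2) ℂ, LinearMap.toContinuousLinearMap (Matrix.traceLinearMap (Fin 2) ℂ ℂ) (a * b)
      = LinearMap.toContinuousLinearMap (Matrix.traceLinearMap (Fin 2) ℂ ℂ) (b * a) := fun a b => by
    simp only [LinearMap.coe_toContinuousLinearMap']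
    exact traceLinearMap_mul_comm a b
  have h1 := two_mul_bondPair_covDη_deltaOp T U (hT ▸ torusT_comm) (LinearMap.toContinuousLinearMap (Matrix.traceLinearMap (Fin 2) ℂ ℂ)) hτ'
    one_ne_zero 3 (formComp X) (star lam)
  rw [LinearMap.coe_toContinuousLinearMap] at h1
  have h2 : bondPair 1 3 (Matrix.traceLinearMap (Fin 2) ℂ ℂ) (covDη T U 1 (star lam)) (deltaOp T U 1 (formComp X))
      = (2 : ℂ)⁻¹ * bondPair 1 3 (Matrix.traceLinearMap (Fin 2) ℂ ℂ)
          (fun μ x => I • ad (star lam x) (formComp X μ x) - I • ad (formComp X μ x) (R (U μ x) (star lam (T μ x)))) (J T U 1) := by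
    rw [← h1]; ring
  rw [h2]
  push_cast
  ring

/-- ★★ **THE ALGEBRA OF `Δ_πᴾ = PᴾᵀΔ^ηPᴾ` ON THE LANDAU SLICE**: for `R_S(D* y) = 0` (so `Pᴾy = y`), `⟪x, Δ^η y⟫ − ⟪x, Δ_πᴾ y⟫ = ⟪D(G′ᴾ(R_S(D* x))), Δ^η y⟫` — the slot defect pairs `x`
with `Δ^η y` only through the pure-gauge part `D G′ᴾR_SD* x` of `x`. [cite: Balaban1985BackgroundPropagators, (3.119)–(3.120) p.419] -/
theorem inner_DeltaEta_sub_DeltaPiP_of_landau [Fact (0 < c₀)] [Fact (0 < cB)] (U₀ : GaugeField (F.P K) 0 (Matrix.specialUnitaryGroup (Fin 2) ℂ))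
    (x y : BondL2K ℂ 3 (periodsT3 F K) c₀ W₂) (hy : RS F n K h c₀ cB U₀ (DstarL2 F n K c₀ U₀ y) = 0) :
    ⟪x, DeltaEta F n K c₀ U₀ y⟫_ℂ - ⟪x, DeltaPiP F n K h c₀ cB a U₀ y⟫_ℂ
      = ⟪DL2 F n K c₀ U₀ (GprimeP F n K h c₀ cB a U₀ (RS F n K h c₀ cB U₀ (DstarL2 F n K c₀ U₀ x))), DeltaEta F n K c₀ U₀ y⟫_ℂ := by
  have hPy : gaugeCorrP F n K h c₀ cB a U₀ y = y := by
    rw [gaugeCorrP_apply, hy, map_zero, map_zero, sub_zero]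
  rw [inner_DeltaPiP, hPy, gaugeCorrP_apply, inner_sub_left]
  ring

end Member

/-! ## §3 The two elementary bounds: the pairing with the bracket, and the unit-spacing current on `RegPr` -/

section Bounds

variable {F : T3Family} {n K : ℕ}

/-- ★ **THE PAIRING ESTIMATE: `‖⟨i[λ(b₋), F(b)] − i[F(b), R_bλ(b₊)], E⟩₁‖ ≤ 24·s·j·Σ_x‖λ x‖`** at unit spacing, `d = 3`, `τ := tr`, for `‖F(b)‖ ≤ s`, `‖E(b)‖ ≤ j` (lit ✓`norm_I_ad_le`, unitary
transport `‖R_bλ(b₊)‖ ≤ ‖λ(b₊)‖`, the shift `x ↦ x + e_μ` a bijection) — the `L^∞(F) × L¹(λ)` shape dual to lit's ✓`norm_two_mul_bondPair_deltaOp_covDη_le`.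
[cite: Balaban1985Variational, (138)–(139) p.299; Balaban1985BackgroundPropagators, (3.131) p.422] -/
theorem norm_bondPair_linJ_le (U₀ : GaugeField (F.P K) 0 (Matrix.specialUnitaryGroup (Fin 2) ℂ)) (lam : Site (F.P K) 0 → Matrix (Fin 2) (Fin 2) ℂ)
    (Fμ E : Fin (F.P K).d → Site (F.P K) 0 → Matrix (Fin 2) (Fin 2) ℂ) {s j : ℝ} (hF : ∀ μ x, ‖Fμ μ x‖ ≤ s) (hE : ∀ μ x, ‖E μ x‖ ≤ j) :
    ‖bondPair 1 3 (Matrix.traceLinearMap (Fin 2) ℂ ℂ)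
        (fun μ x => I • ad (lam x) (Fμ μ x) - I • ad (Fμ μ x) (R (bgUnits F K U₀ ⟨x, μ⟩) (lam (torusT (F.P K) 0 μ x)))) E‖
      ≤ 24 * s * j * ∑ x : Site (F.P K) 0, ‖lam x‖ := by
  have hs : 0 ≤ s := (norm_nonneg _).trans (hF 0 (Classical.arbitrary _))
  have hj : 0 ≤ j := (norm_nonneg _).trans (hE 0 (Classical.arbitrary _))
  rw [bondPair, Complex.ofReal_one, one_pow, one_mul]
  -- pointwise: `|tr(bracket·E)| ≤ 2·(2·(‖λ x‖ + ‖λ(x+e_μ)‖)·s)·j = 4·s·j·(…)`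
  have hpt : ∀ (μ : Fin (F.P K).d) (x : Site (F.P K) 0),
      ‖Matrix.traceLinearMap (Fin 2) ℂ ℂ ((I • ad (lam x) (Fμ μ x) - I • ad (Fμ μ x) (R (bgUnits F K U₀ ⟨x, μ⟩) (lam (torusT (F.P K) 0 μ x)))) * E μ x)‖
        ≤ 4 * s * j * (‖lam x‖ + ‖lam (x.shift μ)‖) := by
    intro μ x
    rw [Matrix.traceLinearMap_apply, B9TorusCalculus.torusT_apply]
    refine (FlatPlaqDeriv.norm_trace_mul_le _ _).trans ?_
    have hR : ‖R (bgUnits F K U₀ ⟨x, μ⟩) (lam (x.shift μ))‖ ≤ ‖lam (x.shift μ)‖ :=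
      norm_R_le (norm_bgUnits_le_one F K U₀ ⟨x, μ⟩).1 (norm_bgUnits_le_one F K U₀ ⟨x, μ⟩).2 _
    have hFx := hF μ x
    have hlin : ‖I • ad (lam x) (Fμ μ x) - I • ad (Fμ μ x) (R (bgUnits F K U₀ ⟨x, μ⟩) (lam (x.shift μ)))‖ ≤ 2 * (‖lam x‖ + ‖lam (x.shift μ)‖) * s := by
      refine (norm_sub_le _ _).trans ?_
      have h1 : ‖I • ad (lam x) (Fμ μ x)‖ ≤ 2 * ‖lam x‖ * s :=
        (norm_I_ad_le _ _).trans (mul_le_mul_of_nonneg_left hFx (by positivity))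
      have h2 : ‖I • ad (Fμ μ x) (R (bgUnits F K U₀ ⟨x, μ⟩) (lam (x.shift μ)))‖ ≤ 2 * s * ‖lam (x.shift μ)‖ :=
        (norm_I_ad_le _ _).trans (by nlinarith [hR, hFx, norm_nonneg (Fμ μ x), norm_nonneg (R (bgUnits F K U₀ ⟨x, μ⟩) (lam (x.shift μ))), norm_nonneg (lam (x.shift μ))])
      linarith [h1, h2]
    have h1 : 2 * ‖I • ad (lam x) (Fμ μ x) - I • ad (Fμ μ x) (R (bgUnits F K U₀ ⟨x, μ⟩) (lam (x.shift μ)))‖ * ‖E μ x‖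
        ≤ 2 * (2 * (‖lam x‖ + ‖lam (x.shift μ)‖) * s) * j :=
      mul_le_mul (mul_le_mul_of_nonneg_left hlin (by norm_num)) (hE μ x) (norm_nonneg _) (by positivity)
    linarith [h1]
  refine (norm_sum_le _ _).trans ?_
  refine (Finset.sum_le_sum fun x _ => (norm_sum_le _ _).trans (Finset.sum_le_sum fun μ _ => hpt μ x)).trans ?_
  -- the shift is a bijection: `Σ_x ‖λ(x + e_μ)‖ = Σ_x ‖λ x‖`
  have hshift : ∀ μ : Fin (F.P K).d, ∑ x : Site (F.P K) 0, ‖lam (x.shift μ)‖ = ∑ x : Site (F.P K) 0, ‖lam x‖ := fun μ =>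
    Equiv.sum_comp (torusT (F.P K) 0 μ) (fun x => ‖lam x‖)
  have hd : (Finset.univ : Finset (Fin (F.P K).d)).card = 3 := by rw [Finset.card_univ, Fintype.card_fin]; rfl
  rw [Finset.sum_comm]
  simp only [mul_add, Finset.sum_add_distrib, ← Finset.mul_sum, hshift, Finset.sum_const, hd, nsmul_eq_mul, Nat.cast_ofNat]
  linarith

/-- ★★ **THE UNIT-SPACING CURRENT ON THE PRINTED-REGULAR CLASS: `‖J₁(b)‖ ≤ α·η³` on `RegPr F n K α U₀`** — `J₁ = D¹*(Im ∂U₀) = −(I∕2)•(D¹*(∂U₀ − 1) − (D¹*(∂U₀ − 1))ᴴ)` (✓`imC`, unitarity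
✓`plaqU_unitary`, ✓`star_divP`), `D¹*(∂U₀ − 1) = covDivT 1 ∂U₀` (★p1 ✓`divP_plaqFT_sub_one_eq_covDivT`), and the DIVERGENCE CLAUSE `RegPr.divSmall`: `‖covDivT 1 ∂U₀ (b)‖ < α·L^{−3(K−n)}`.
This — not the plaquette clause — is what makes the (139)-type rows `K`-uniform. [cite: Balaban1985Variational, (2) p.278, (28) p.282; Balaban1985RegularSpaces, (1.9) p.77; Balaban1985BackgroundPropagators, (3.11) p.392] -/
theorem norm_J_one_le_of_regPr {α : ℝ} (U₀ : GaugeField (F.P K) 0 (Matrix.specialUnitaryGroup (Fin 2) ℂ)) (hreg : RegPr F n K α U₀)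
    (μ : Fin (F.P K).d) (x : Site (F.P K) 0) :
    ‖J (torusT (F.P K) 0) (fun μ x => bgUnits F K U₀ ⟨x, μ⟩) 1 μ x‖ ≤ α * eta F n K ^ 3 := by
  set T := torusT (F.P K) 0 with hT
  set U : Fin (F.P K).d → Site (F.P K) 0 → (Matrix (Fin 2) (Fin 2) ℂ)ˣ := fun μ x => bgUnits F K U₀ ⟨x, μ⟩ with hU
  -- the divergence clause at the bond `⟨x, μ⟩`
  have hdiv := hreg.divSmall ⟨x, μ⟩
  have hη3 : ((F.L : ℝ)⁻¹) ^ (3 * (K - n)) = eta F n K ^ 3 := by rw [eta, ← pow_mul, mul_comm]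
  rw [hη3] at hdiv
  -- `D¹*(∂U₀ − 1) = covDivT 1 ∂U₀`
  have hd : divP T U (fun κ κ' z => (plaqU T U κ κ' z : Matrix (Fin 2) (Fin 2) ℂ) - 1) μ x = covDivT 1 (bgUnits F K U₀) μ x := by
    have e : (fun κ κ' z => (plaqU T U κ κ' z : Matrix (Fin 2) (Fin 2) ℂ) - 1) = (fun κ κ' z => plaqFT (bgUnits F K U₀) κ κ' z - 1) := by
      funext κ κ' z; rw [hT, hU, val_plaqU_torusT_eq_plaqFT]
    rw [e]
    exact divP_plaqFT_sub_one_eq_covDivT (bgUnits F K U₀) μ x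
  -- `J₁ = −(I/2)•(D¹*(∂U₀ − 1) − (D¹*(∂U₀ − 1))ᴴ)`
  have hUu : ∀ μ x, ((((fun μ x => bgUnits F K U₀ ⟨x, μ⟩) μ x)⁻¹ : (Matrix (Fin 2) (Fin 2) ℂ)ˣ) : Matrix (Fin 2) (Fin 2) ℂ)
      = star (((fun μ x => bgUnits F K U₀ ⟨x, μ⟩) μ x : (Matrix (Fin 2) (Fin 2) ℂ)ˣ) : Matrix (Fin 2) (Fin 2) ℂ) := fun μ x => val_inv_bgUnits_eq_star U₀ μ x
  have hJ : J T U 1 μ x = (2 * I)⁻¹ • (divP T U (fun κ κ' z => (plaqU T U κ κ' z : Matrix (Fin 2) (Fin 2) ℂ) - 1) μ x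
      - star (divP T U (fun κ κ' z => (plaqU T U κ κ' z : Matrix (Fin 2) (Fin 2) ℂ) - 1) μ x)) := by
    have hJ1 : J T U 1 μ x = divP T U (fun κ κ' z => imC (plaqU T U κ κ' z)) μ x := by
      simp only [J, divPη, Complex.ofReal_one, inv_one, one_pow, one_smul]
    have him : (fun κ κ' z => imC (plaqU T U κ κ' z))
        = (2 * I)⁻¹ • ((fun κ κ' z => (plaqU T U κ κ' z : Matrix (Fin 2) (Fin 2) ℂ) - 1)
            + (-1 : ℂ) • star (fun κ κ' z => (plaqU T U κ κ' z : Matrix (Fin 2) (Fin 2) ℂ) - 1)) := by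
      funext κ κ' z
      simp only [Pi.smul_apply, Pi.add_apply, Pi.neg_apply, Pi.star_apply, neg_one_smul, star_sub, star_one]
      rw [imC, plaqU_unitary T U hUu]
      congr 1
      abel
    rw [hJ1, him, B9Eq39Adjoint.divP_smul, B9Eq310Hermitian.divP_add, B9Eq39Adjoint.divP_smul, ← star_divP T U hUu,
      neg_one_smul, sub_eq_add_neg]
  rw [hJ, norm_smul]
  have hc : ‖(2 * I : ℂ)⁻¹‖ = 2⁻¹ := by simp
  rw [hc, hd]
  calc 2⁻¹ * ‖covDivT 1 (bgUnits F K U₀) μ x - star (covDivT 1 (bgUnits F K U₀) μ x)‖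
      ≤ 2⁻¹ * (‖covDivT 1 (bgUnits F K U₀) μ x‖ + ‖star (covDivT 1 (bgUnits F K U₀) μ x)‖) := by gcongr; exact norm_sub_le _ _
    _ = ‖covDivT 1 (bgUnits F K U₀) μ x‖ := by rw [norm_star]; ring
    _ ≤ α * eta F n K ^ 3 := hdiv.le

end Bounds

end Summit.QuantumFields.YangMills.Theorems.Prop7DeltaPiDefectPairing

end
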